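import Summits.Ventures.PercRepro.RankLevelSetLevelFiveCqFifteenFive
import Summits.Ventures.PercRepro.S2FourteenNine
import Summits.Ventures.PercRepro.S2FourteenTenG

/-!
# PercRepro — S2: THEOREM C₅ AT `15` MODULO THE THREE CELLS `(14, 6)`, `(14, 7)`, `(14, 8)` (p7, gen 13; sub-claim S2; the `p = 14` row)

p1's `c025_five_large_sharp15_of_five_cells` with the cells `(14, 9)` and `(14, 10)` discharged by `c025_core_five_fourteen_nine`
(S2FourteenNine: the graded partition count at `ν = 6`) and `c025_core_five_fourteen_ten` (S2FourteenTenG: the sharpened flat count at `ν = 8`,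
the graded partition count at `ν = 7`):
**`c025_five_large_sharp15_of_three_cells (hthree : the cells (14, 6 … 8)) (M) (p) (hp : 15 ≤ p) : RLS M p 5`** — C-025 at level `5` for every
`p ≥ 15` MODULO the three cells `(14, 6)`, `(14, 7)`, `(14, 8)`. The window is NOT moved by this file. Axioms: standard.
-/

open scoped Matroid

namespace PercRepro

namespace ThmN

variable {α : Type}

/-- **THEOREM C₅ AT `15` MODULO THE THREE CELLS** `(14, 6)`, `(14, 7)`, `(14, 8)`: the cells `(14, 9)` and `(14, 10)` are
`c025_core_five_fourteen_nine` and `c025_core_five_fourteen_ten`. -/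
theorem c025_five_large_sharp15_of_three_cells
    (hthree : ∀ (M : Matroid α) [M.Finite] (d : ℕ), 6 ≤ d → d ≤ 8 → M.eRank = ((14 : ℕ) : ℕ∞) →
      M.E.ncard = 14 + d →
      (∀ e ∈ M.E, ∃ A ⊆ M.E \ {e}, e ∉ M.closure A ∧ e ∉ M.closure ((M.E \ {e}) \ A)) → RLS M 14 5)
    (M : Matroid α) [M.Finite] (p : ℕ) (hp : 15 ≤ p) : RLS M p 5 := by
  refine c025_five_large_sharp15_of_five_cells ?_ M p hp
  intro M _ d hd6 hd10 hR hn hfree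
  rcases Nat.lt_or_ge d 9 with h | h
  · exact hthree M d hd6 (by omega) hR hn hfree
  · rcases Nat.lt_or_ge d 10 with h9 | h10
    · obtain rfl : d = 9 := by omega
      exact c025_core_five_fourteen_nine M hR hn hfree
    · obtain rfl : d = 10 := by omega
      exact c025_core_five_fourteen_ten M hR hn hfree

end ThmN

end PercRepro
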